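import Summits.ResolutionOfSingularities.ResolutionOfSingularities.Theorems.EquisingularLiftEquisingularLiftNatEmbeddedLiftDifferenceClass
import Mathlib.RingTheory.Flat.EquationalCriterion
import Mathlib.LinearAlgebra.Span.Basic
import HarnessLib

/-!
# [OURS · L1 W4.5(b) · EL♮(3) · (T-k) · J1c ring bricks] Laws of the difference class: `I ∩ 𝔪A ⊆ 𝔪A·I` for flat quotients, equality of comparable
# flat lifts, transitivity / antisymmetry / base change of `liftDiff` (Hartshorne 2010 Thm. 6.2 (a): «the operation … is an action»; §2 «compatible with localization»)

Crux chain w45b (cell `res-hironaka`, slot W4.5(b)), working crux **EL♮** = stmt-ResolutionOfSingularities-20038, child **EL♮(3)** =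
stmt-ResolutionOfSingularities-20148; NEED-FACT of record J1 = `EmbeddedInfinitesimalLiftFact` (p596985). Written by res-type-027 g16 after J1a (p598761),
J1b-α (p599860, `liftDiff`) and J1b-β (…NatEmbeddedLiftTorsorAction, `act`): the ring-level laws the sheaf-level patching J1c will consume.
HONEST FRAMING: OURS; NOT a statement of H. Hironaka's 2017 manuscript; AI-written, gate-checked, weaker than expert review. No `sorry`; standard axioms;
DEF-FREE. `--supports stmt-ResolutionOfSingularities-20148 --as helper`.
* `mem_smul_of_mem_inf_map_of_flat` — `A/I` flat over `C` ⇒ `I ∩ 𝔪A ⊆ 𝔪A·I` (`Tor₁^C(C/𝔪, A/I) = 0`, via Mathlib's equational criterion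
  `Module.Flat.isTrivialRelation_of_sum_smul_eq_zero`);
* `eq_of_le_of_le_sup_map_of_flat` — (c0) `I₁ ≤ I₂`, `A/I₂` flat, `I₂ ≤ I₁ + 𝔪A`, `𝔪` nilpotent ⇒ `I₁ = I₂` (local uniqueness of lifts with given
  generators: J1c's local-existence step takes `I₁ = (lifted regular sequence)` from J1a);
* `liftDiff_trans`, `liftDiff_symm` — (c2) cocycle and inverse laws of the difference class on representatives;
* `liftDiff_map`, `map_le_map_sup_span` — (c1) compatibility of the difference class with `C`-algebra maps `A → A₂` (restriction to smaller affine opens).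
References (method / index only): R. Hartshorne, *Deformation Theory* (2010), Thm. 6.2 (a) proof p. 47, §2 p. 11; The Stacks Project, Tag 00HK.
-/

set_option linter.dupNamespace false

noncomputable section

open IsLocalRing Pointwise

namespace Summit.ResolutionOfSingularities.ResolutionOfSingularities.Cruxes.EquisingularLiftNat.Sections

universe u v w

variable {C : Type u} [CommRing C] {A : Type v} [CommRing A] [Algebra C A]

/-! ## (c0) `I ∩ 𝔪A = 𝔪I` for a flat quotient, and equality of comparable flat lifts -/

/-- **`I ∩ 𝔪A ⊆ 𝔪A·I` when `A/I` is flat over `C`** (`Tor₁^C(C/𝔪, A/I) = 0`; equational criterion of flatness: a relation `Σ mᵢ[aᵢ] = 0` in the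
flat `A/I` is trivial). [cite: StacksProject, Tag 00HK] [folklore] -/
theorem mem_smul_of_mem_inf_map_of_flat (𝔪 : Ideal C) (I : Ideal A) [Module.Flat C (A ⧸ I)] {x : A}
    (hxI : x ∈ I) (hxm : x ∈ 𝔪.map (algebraMap C A)) : x ∈ 𝔪.map (algebraMap C A) * I := by
  classical
  -- `x = Σ mᵢ aᵢ`
  rw [Ideal.map, ← Ideal.submodule_span_eq, Submodule.mem_span_set'] at hxm
  obtain ⟨n, b, g, hx⟩ := hxm
  have hg : ∀ i, ∃ m ∈ 𝔪, algebraMap C A m = (g i : A) := fun i => by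
    obtain ⟨m, hm, hgm⟩ := (g i).2; exact ⟨m, hm, hgm⟩
  choose m hm hgm using hg
  -- the relation `Σ mᵢ [bᵢ] = 0` in `A/I`
  have hrel : ∑ i, m i • (Ideal.Quotient.mk I (b i)) = 0 := by
    have : Ideal.Quotient.mk I x = 0 := Ideal.Quotient.eq_zero_iff_mem.mpr hxI
    rw [← hx, map_sum] at this
    rw [← this]
    refine Finset.sum_congr rfl fun i _ => ?_
    rw [smul_eq_mul, map_mul, ← hgm, Algebra.smul_def, IsScalarTower.algebraMap_apply C A (A ⧸ I), Ideal.Quotient.algebraMap_eq, mul_comm]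
  obtain ⟨k, c, y, hb, hc⟩ := Module.Flat.isTrivialRelation_of_sum_smul_eq_zero hrel
  -- lift the `yⱼ`
  choose yl hyl using fun j => Ideal.Quotient.mk_surjective (y j)
  have hr : ∀ i, b i - ∑ j, c i j • yl j ∈ I := by
    intro i
    have hbi : Ideal.Quotient.mk I (b i) = ∑ j, c i j • y j := hb i
    rw [← Ideal.Quotient.eq, hbi, map_sum]
    refine Finset.sum_congr rfl fun j _ => ?_
    rw [← hyl j, Algebra.smul_def, Algebra.smul_def, map_mul, IsScalarTower.algebraMap_apply C A (A ⧸ I),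
      Ideal.Quotient.algebraMap_eq]
  -- `x = Σᵢ mᵢ (bᵢ - Σⱼ cᵢⱼ ỹⱼ) + Σⱼ (Σᵢ mᵢ cᵢⱼ) ỹⱼ`, the second sum being zero
  have hx' : x = ∑ i, m i • (b i - ∑ j, c i j • yl j) := by
    have hzero : ∑ i, m i • ∑ j, c i j • yl j = 0 := by
      calc ∑ i, m i • ∑ j, c i j • yl j = ∑ j, (∑ i, m i * c i j) • yl j := by
            simp_rw [Finset.smul_sum, ← mul_smul]; rw [Finset.sum_comm]; simp_rw [Finset.sum_smul]
        _ = 0 := by simp [hc]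
    rw [← hx]
    simp_rw [smul_sub, Finset.sum_sub_distrib, hzero, sub_zero]
    refine Finset.sum_congr rfl fun i _ => ?_
    rw [smul_eq_mul, ← hgm, Algebra.smul_def, mul_comm]
  rw [hx']
  refine Ideal.sum_mem _ fun i _ => ?_
  rw [Algebra.smul_def]
  exact Ideal.mul_mem_mul (Ideal.mem_map_of_mem _ (hm i)) (hr i)

/-- **Comparable flat lifts with the same reduction are equal**: `I₁ ≤ I₂`, `A/I₂` flat over `C`, `I₂ ≤ I₁ + 𝔪A`, `𝔪` nilpotent ⇒ `I₁ = I₂`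
(`I₂ ≤ I₁ + 𝔪I₂` by `mem_smul_of_mem_inf_map_of_flat`, then iterate). [folklore] -/
theorem eq_of_le_of_le_sup_map_of_flat (𝔪 : Ideal C) (hnil : IsNilpotent 𝔪) (I₁ I₂ : Ideal A) [Module.Flat C (A ⧸ I₂)]
    (hle : I₁ ≤ I₂) (h : I₂ ≤ I₁ ⊔ 𝔪.map (algebraMap C A)) : I₁ = I₂ := by
  refine le_antisymm hle ?_
  obtain ⟨n, hn⟩ := hnil
  have key : ∀ k : ℕ, I₂ ≤ I₁ ⊔ (𝔪 ^ k).map (algebraMap C A) * I₂ := by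
    intro k
    induction k with
    | zero => rw [pow_zero, Ideal.one_eq_top, Ideal.map_top, Ideal.top_mul]; exact le_sup_right
    | succ k ih =>
      intro x hx
      obtain ⟨i, hi, m, hm, rfl⟩ := Submodule.mem_sup.mp (h hx)
      have hm2 : m ∈ I₂ := by simpa using I₂.sub_mem hx (hle hi)
      have hm' : m ∈ 𝔪.map (algebraMap C A) * I₂ := mem_smul_of_mem_inf_map_of_flat 𝔪 I₂ hm2 hm
      have hstep : 𝔪.map (algebraMap C A) * I₂ ≤ I₁ ⊔ (𝔪 ^ (k + 1)).map (algebraMap C A) * I₂ := by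
        calc 𝔪.map (algebraMap C A) * I₂ ≤ 𝔪.map (algebraMap C A) * (I₁ ⊔ (𝔪 ^ k).map (algebraMap C A) * I₂) :=
              Ideal.mul_mono_right ih
          _ = 𝔪.map (algebraMap C A) * I₁ ⊔ (𝔪 ^ (k + 1)).map (algebraMap C A) * I₂ := by
              rw [Ideal.mul_sup, ← mul_assoc, ← Ideal.map_mul, ← pow_succ']
          _ ≤ I₁ ⊔ (𝔪 ^ (k + 1)).map (algebraMap C A) * I₂ := sup_le_sup_right Ideal.mul_le_left _
      exact Submodule.add_mem _ (Ideal.mem_sup_left hi) (hstep hm')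
  have hk := key n
  rw [hn, Ideal.zero_eq_bot, Ideal.map_bot, Ideal.bot_mul, sup_bot_eq] at hk
  exact hk

/-! ## (c2) Transitivity of the difference class (representatives) -/

section Laws

variable {𝔪 : Ideal C} {ε : C} (hann : ∀ c : C, ε * c = 0 ↔ c ∈ 𝔪)

/-- **Transitivity**: if `x₁ − εy ∈ I₂` and `(x₁ − εy) − εz ∈ I₃` then `φ_{I₁,I₃}(x₁) = [y + z]` — the cocycle law `φ₁₃ = φ₁₂ + φ₂₃` on representatives.
[cite: Hartshorne2010, Thm. 6.2 (a) («the operation … is an action»)] -/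
theorem liftDiff_trans (I₁ I₂ I₃ : Ideal A) [Module.Flat C (A ⧸ I₃)] (h₁₃ : I₁ ≤ I₃ ⊔ Ideal.span {algebraMap C A ε})
    (x : I₁) (y z : A) (hy : (x : A) - algebraMap C A ε * y ∈ I₂) (hz : ((x : A) - algebraMap C A ε * y) - algebraMap C A ε * z ∈ I₃) :
    liftDiff hann I₁ I₃ h₁₃ x = Ideal.Quotient.mk _ (y + z) := by
  have _ := hy
  refine liftDiff_apply_of_sub_mem hann I₁ I₃ h₁₃ x (y + z) ?_
  rw [mul_add, ← sub_sub]; exact hz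

/-- **Antisymmetry**: if `x₁ − εy ∈ I₂` (so `φ₁₂(x₁) = [y]`) then for the element `x₂ = x₁ − εy ∈ I₂` one has `x₂ − ε(−y) = x₁ ∈ I₁`, i.e.
`φ₂₁(x₂) = −[y]`. [folklore] -/
theorem liftDiff_symm (I₁ I₂ : Ideal A) [Module.Flat C (A ⧸ I₁)] (h₂₁ : I₂ ≤ I₁ ⊔ Ideal.span {algebraMap C A ε})
    (x : I₁) (y : A) (hy : (x : A) - algebraMap C A ε * y ∈ I₂) :
    liftDiff hann I₂ I₁ h₂₁ ⟨(x : A) - algebraMap C A ε * y, hy⟩ = -Ideal.Quotient.mk _ y := by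
  rw [← map_neg]
  refine liftDiff_apply_of_sub_mem hann I₂ I₁ h₂₁ _ (-y) ?_
  simp only [mul_neg, sub_neg_eq_add, sub_add_cancel, SetLike.coe_mem]

/-! ## (c1) Base change of the difference class along an algebra map -/

variable {A₂ : Type w} [CommRing A₂] [Algebra C A₂]

/-- **Base change** (e.g. localisation to a smaller affine open): for a `C`-algebra map `f : A → A₂`, lifts `I', I''` of `A` and their extensions
`I'A₂, I''A₂` (with `A₂/I''A₂` flat), the difference classes are compatible: `φ_{I'A₂, I''A₂}(f x') = [f y]` whenever `x' − εy ∈ I''`.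
[folklore; Hartshorne 2010 §2 «the construction is compatible with localization»] -/
theorem liftDiff_map (f : A →ₐ[C] A₂) (I' I'' : Ideal A) [Module.Flat C (A₂ ⧸ I''.map f)]
    (hI : I' ≤ I'' ⊔ Ideal.span {algebraMap C A ε}) (hI₂ : I'.map f ≤ I''.map f ⊔ Ideal.span {algebraMap C A₂ ε})
    (x : I') (y : A) (h : (x : A) - algebraMap C A ε * y ∈ I'') :
    liftDiff hann (I'.map f) (I''.map f) hI₂ ⟨f x, Ideal.mem_map_of_mem f x.2⟩ = Ideal.Quotient.mk _ (f y) := by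
  have _ := hI
  refine liftDiff_apply_of_sub_mem hann (I'.map f) (I''.map f) hI₂ _ (f y) ?_
  have := Ideal.mem_map_of_mem f h
  simpa [map_sub, map_mul, AlgHom.commutes] using this

/-- The hypothesis `I'A₂ ≤ I''A₂ + (ε)` follows from `I' ≤ I'' + (ε)`. [folklore] -/
theorem map_le_map_sup_span (f : A →ₐ[C] A₂) (I' I'' : Ideal A) (hI : I' ≤ I'' ⊔ Ideal.span {algebraMap C A ε}) :
    I'.map f ≤ I''.map f ⊔ Ideal.span {algebraMap C A₂ ε} := by
  calc I'.map f ≤ (I'' ⊔ Ideal.span {algebraMap C A ε}).map f := Ideal.map_mono hI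
    _ = I''.map f ⊔ Ideal.span {algebraMap C A₂ ε} := by
        rw [Ideal.map_sup, Ideal.map_span, Set.image_singleton, AlgHom.commutes]

end Laws

end Summit.ResolutionOfSingularities.ResolutionOfSingularities.Cruxes.EquisingularLiftNat.Sections

end
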